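import Summits.CriticalPhenomena.SAWScalingLimit.Theorems.SAWTotalPositivityCriticalBubbleBoundJoinSurgeryDefs

/-!
# Objects of the JOIN-MASS programme, III: MACROSCOPIC global join plaquettes and the door's obligation
(crux `SAWTotalPositivity.CriticalBubbleBound`, stmt-CriticalPhenomena-7117; line `docking-census-joining`,
lead prover c7, crux protocol)

The join-mass bootstrap (Hammond, *An upper bound on the number of self-avoiding polygons via joining*,
Ann. Probab. 46 (2018) §4, landed as `Join.joinMass_blockDecay`) feeds the ledger
`Docking.stub_ledgerBootstrap` with docking ENTROPY `κ = 3/2` (`Join.Dent_ge`) and RARITY `π = 0` for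
GLOBAL join plaquettes (`Join.Urar_le_of_tail`, `Join.gjoins_tail_bound`). The ledger closes the crux as soon
as `κ + π > 2`; `π = 0` is sharp for `Urar` (a unit-square "ear" carrying the rightmost column is a global
join plaquette of positive density), but the join's images are MACROSCOPIC: the junction flip returns the two
partners, each carrying at least a quarter of the join's edges. This file DEFINES the restricted rarity side
and the two exponent statements of the door; no statement of the programme is asserted here.

* `IsMacroJoin n χ q` — a global join plaquette of `P(χ)` (Hammond Def. 4.4, anchor at the root) whose flip
  splits the `(n+1)`-edge polygon into two polygons EACH with at least a quarter of the edges;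
  `mjoins n χ` their set (`⊆ gjoins n χ`);
* `Umac i` — the MACROSCOPIC rarity-side mass `Σ_{targets of scale i+1} |mjoins| · x_c^{|J|}` (`≤ Urar i`);
* `JoinMacroRarity π` (`@[conjecture]`, obligation node) — the rarity input of the ledger for `Umac` with
  exponent `π`: `Umac i ≤ C (i+1)^b 2^{-π i} R'_{i+1} + C 2^{-4 i}`; the door needs `π > 1/2`; heuristic
  value `π₀ = ν (x₄ - 2) = 11/16` (`ν = 3/4`, `x₄ = 35/12` the four-leg watermelon exponent of planar
  polymers: a critical polygon of length `N` carries `≍ N^{2ν} · N^{-ν x₄} = N^{-11/16}` macroscopic pinch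
  plaquettes on average);
* `JoinEntropyAt κ` — the entropy input of the ledger for the shifted class blocks with exponent `κ`
  (`κ = 3/2` is the tree theorem `Join.Dent_ge`; `κ = 1 + ν = 7/4` conjecturally).

Elementary API: `mjoins ⊆ gjoins`, `0 ≤ Umac i ≤ Urar i` (registered infrastructure sub-goals `Umac_nonneg`,
`Umac_le_Urar`).

Sources: A. Hammond, Ann. Probab. 46 (2018) 175–206 = arXiv:1808.09032, Def. 2.3, Def. 4.4, Prop. 4.5, Lemma 4.12;
B. Duplantier, H. Saleur, Phys. Rev. Lett. 57 (1986) 3179 (network exponents).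
-/

noncomputable section

open Literature.Probability.LatticeModels
open Literature.Probability.RandomPlanarGeometry Literature.Probability.RandomPlanarGeometry.SAW
open scoped BigOperators
open Summit.CriticalPhenomena.SAWScalingLimit.Theorems.CriticalBubbleBound.Negative (e₀)
open Summit.CriticalPhenomena.SAWScalingLimit.Theorems.CriticalBubbleBound.Docking

namespace Summit.CriticalPhenomena.SAWScalingLimit.Theorems.CriticalBubbleBound.Join

/-! ## Macroscopic global join plaquettes -/

/-- MACROSCOPIC GLOBAL JOIN PLAQUETTE of the lex-rooted polygon `P(χ)` at `q`: a join plaquette whose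
flip splits `P(χ)` (`n + 1` edges) into two vertex-disjoint polygons `E₁ ∋ 0`, `E₂ ⊇` all rightmost
vertices (Hammond Def. 4.4 with the anchor at the root, as in `IsGlobalJoin`), EACH of which carries at
least a quarter of the edges: `n + 1 ≤ 4 |E₁|` and `n + 1 ≤ 4 |E₂|`. The Madras join of two classes of the
same dyadic block, re-rooted, has its junction corner of this kind. [cite: Hammond2015SAPJoining, Definition 4.4] -/
def IsMacroJoin (n : ℕ) (χ : ℕ → Site 2) (q : Site 2) : Prop :=
  IsJoinPlaq (pedges n χ) q ∧
    ∃ E₁ E₂ : Finset (Sym2 (Site 2)),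
      IsPolygon (zdGraph 2) E₁ ∧ IsPolygon (zdGraph 2) E₂ ∧
      (∀ x : Site 2, (∃ e ∈ E₁, x ∈ e) → (∃ e ∈ E₂, x ∈ e) → False) ∧
      E₁ ∪ E₂ = flipH (pedges n χ) q ∧
      (∃ e ∈ E₁, (0 : Site 2) ∈ e) ∧
      (∀ v ∈ rightCol n χ, ∃ e ∈ E₂, v ∈ e) ∧
      n + 1 ≤ 4 * E₁.card ∧ n + 1 ≤ 4 * E₂.card

open Classical in
/-- The set of (lower-left corners of) macroscopic global join plaquettes of `P(χ)`.
[cite: Hammond2015SAPJoining, Definition 4.4] -/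
def mjoins (n : ℕ) (χ : ℕ → Site 2) : Finset (Site 2) := (verts n χ).filter (IsMacroJoin n χ)

/-- MACROSCOPIC rarity-side mass of the ledger at scale `i`: over the targets of the join (shifted index
`n ∈ B_{i+1}`, classes of walk length `n - 17`), the number of macroscopic global join plaquettes times
the class weight: `Umac_i = Σ_{n ∈ B_{i+1}, n ≥ 17} Σ_{χ ∈ lexRooted (n-17)} |mjoins| · x_c^{n-17+1}`.
[cite: Hammond2015SAPJoining, Proposition 4.5] -/
def Umac (i : ℕ) : ℝ :=
  ∑ n ∈ block (i + 1), if joinShift ≤ n then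
    ∑ χ ∈ lexRooted (n - joinShift),
      ((mjoins (n - joinShift) χ).card : ℝ) * criticalFugacity ^ (n - joinShift + 1) else 0

/-! ## The two exponent statements of the macroscopic door -/

/-- **Macroscopic join rarity with exponent `π`** (line conjecture of `docking-census-joining`, crux
stmt-CriticalPhenomena-7117; the RESTRICTIVE input of the ledger `θ - 1 = κ + π` for MACROSCOPIC global
join plaquettes): `Umac i ≤ C (i+1)^b 2^{-π i} R'_{i+1} + C 2^{-4 i}` with `R'_{i+1} = blockMass jterm (i+1)`
— a critical polygon class of dyadic scale `2^{i+1}` carries on `x_c`-average at most `≍ (i+1)^b 2^{-π i}`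
global join plaquettes whose flip leaves two polygons of at least a quarter of the edges each (the summable
tail `C 2^{-4i}` accommodates exponentially rare exceptional classes). With the proved entropy `κ = 3/2`
the ledger closes the crux for any `π > 1/2`. Heuristic value `π₀ = ν (x₄ - 2) = 11/16` (four-leg
watermelon exponent `x₄ = 35/12`, `ν = 3/4`); proved: `π = 0` only (every macroscopic global join plaquette
is a global join plaquette, and those are exponentially few, Hammond 2018 Prop. 4.5). A conjecture of THIS
programme, not a result in print. [cite: Hammond2015SAPJoining, Proposition 4.5] -/
@[conjecture] def JoinMacroRarity (π : ℝ) : Prop :=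
  ∃ C b : ℝ, ∀ i : ℕ,
    Umac i ≤ C * ((i : ℝ) + 1) ^ b * (2 : ℝ) ^ (-π * (i : ℝ)) * blockMass jterm (i + 1)
      + C * (2 : ℝ) ^ (-(4 : ℝ) * (i : ℝ))

/-- **Join entropy with exponent `κ`** (the CONSTRUCTIVE input of the ledger for the shifted class
blocks): for all large `i`, `c · 2^{(κ-1) i} · (R'_i)² ≤ Dent i` — two classes of dyadic scale `2^i` are
Madras-joinable at `≳ 2^{(κ-1) i}` admissible vertical offsets on `x_c`-average. `κ = 3/2` is a theorem
of the tree (`Join.Dent_ge`: tall left classes have height `≥ 2^{i/2}/2`); the conjectural value is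
`κ = 1 + ν = 7/4` (typical height `≍ N^{3/4}`); a parametrised statement (obligation node) whose
instance `κ = 3/2` is proved and whose instances `κ > 3/2` are conjectures of THIS programme.
[cite: Hammond2015SAPJoining, Lemma 4.12] -/
@[conjecture] def JoinEntropyAt (κ : ℝ) : Prop :=
  ∃ c : ℝ, 0 < c ∧ ∃ i₀ : ℕ, ∀ i : ℕ, i₀ ≤ i →
    c * (2 : ℝ) ^ ((κ - 1) * (i : ℝ)) * blockMass jterm i ^ 2 ≤ Dent i

/-! ## Elementary API -/

/-- Membership in `mjoins`. [folklore] -/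
theorem mem_mjoins {n : ℕ} {χ : ℕ → Site 2} {q : Site 2} :
    q ∈ mjoins n χ ↔ q ∈ verts n χ ∧ IsMacroJoin n χ q := by
  classical
  exact Finset.mem_filter

/-- A macroscopic global join plaquette is a global join plaquette. [folklore] -/
theorem IsMacroJoin.isGlobalJoin {n : ℕ} {χ : ℕ → Site 2} {q : Site 2} (h : IsMacroJoin n χ q) :
    IsGlobalJoin n χ q := by
  obtain ⟨hq, E₁, E₂, h₁, h₂, hd, hu, h0, hr, -, -⟩ := h
  exact ⟨hq, E₁, E₂, h₁, h₂, hd, hu, h0, hr⟩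

/-- `mjoins ⊆ gjoins`. [folklore] -/
theorem mjoins_subset_gjoins (n : ℕ) (χ : ℕ → Site 2) : mjoins n χ ⊆ gjoins n χ := fun q hq => by
  obtain ⟨hv, hm⟩ := mem_mjoins.1 hq
  exact mem_gjoins.2 ⟨hv, hm.isGlobalJoin⟩

/-- `|mjoins| ≤ |gjoins|`. [folklore] -/
theorem card_mjoins_le (n : ℕ) (χ : ℕ → Site 2) : (mjoins n χ).card ≤ (gjoins n χ).card :=
  Finset.card_le_card (mjoins_subset_gjoins n χ)

/-- The macroscopic rarity-side masses are nonnegative (registered infrastructure sub-goal of the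
programme, carried by this shared definitions file). [folklore] -/
theorem Umac_nonneg : ∀ i : ℕ, 0 ≤ Umac i := by
  intro i
  refine Finset.sum_nonneg fun n _ => ?_
  split_ifs
  · exact Finset.sum_nonneg fun χ _ =>
      mul_nonneg (Nat.cast_nonneg _) (pow_nonneg criticalFugacity_pos_lt_one'.1.le _)
  · exact le_rfl

/-- The macroscopic rarity-side mass is at most the global one: `Umac i ≤ Urar i` (registered
infrastructure sub-goal of the programme; termwise `|mjoins| ≤ |gjoins|`). [folklore] -/
theorem Umac_le_Urar : ∀ i : ℕ, Umac i ≤ Urar i := by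
  intro i
  refine Finset.sum_le_sum fun n _ => ?_
  split_ifs
  · refine Finset.sum_le_sum fun χ _ => ?_
    exact mul_le_mul_of_nonneg_right (by exact_mod_cast card_mjoins_le _ χ)
      (pow_nonneg criticalFugacity_pos_lt_one'.1.le _)
  · exact le_rfl

/-- Unfolding `JoinMacroRarity`. [folklore] -/
theorem joinMacroRarity_iff (π : ℝ) :
    JoinMacroRarity π ↔ ∃ C b : ℝ, ∀ i : ℕ,
      Umac i ≤ C * ((i : ℝ) + 1) ^ b * (2 : ℝ) ^ (-π * (i : ℝ)) * blockMass jterm (i + 1)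
        + C * (2 : ℝ) ^ (-(4 : ℝ) * (i : ℝ)) :=
  Iff.rfl

/-- `JoinMacroRarity` is antitone in the exponent: a larger gain implies a smaller one. [folklore] -/
theorem JoinMacroRarity.anti {π π' : ℝ} (h : JoinMacroRarity π) (hle : π' ≤ π) : JoinMacroRarity π' := by
  obtain ⟨C, b, hC⟩ := h
  have hC0 : 0 ≤ C := by
    have h0 := hC 0
    by_contra hneg
    push Not at hneg
    have h1 : C * ((0 : ℕ) + 1 : ℝ) ^ b * (2 : ℝ) ^ (-π * ((0 : ℕ) : ℝ)) * blockMass jterm (0 + 1) ≤ 0 := by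
      have : 0 ≤ ((0 : ℕ) + 1 : ℝ) ^ b * (2 : ℝ) ^ (-π * ((0 : ℕ) : ℝ)) * blockMass jterm (0 + 1) :=
        mul_nonneg (mul_nonneg (Real.rpow_nonneg (by norm_num) _) (Real.rpow_nonneg (by norm_num) _))
          (blockMass_nonneg jterm_nonneg _)
      nlinarith
    have h2 : C * (2 : ℝ) ^ (-(4 : ℝ) * ((0 : ℕ) : ℝ)) < 0 := by
      simp only [Nat.cast_zero, mul_zero, Real.rpow_zero, mul_one]
      exact hneg
    linarith [Umac_nonneg 0]
  refine ⟨C, b, fun i => le_trans (hC i) ?_⟩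
  have hi : (0 : ℝ) ≤ i := Nat.cast_nonneg i
  have hpow : (2 : ℝ) ^ (-π * (i : ℝ)) ≤ (2 : ℝ) ^ (-π' * (i : ℝ)) :=
    Real.rpow_le_rpow_of_exponent_le (by norm_num) (by nlinarith)
  have hfac : 0 ≤ C * ((i : ℝ) + 1) ^ b := mul_nonneg hC0 (Real.rpow_nonneg (by linarith) _)
  have := mul_le_mul_of_nonneg_left hpow hfac
  have := mul_le_mul_of_nonneg_right this (blockMass_nonneg jterm_nonneg (i + 1))
  linarith

/-- `JoinEntropyAt` is antitone in the exponent. [folklore] -/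
theorem JoinEntropyAt.anti {κ κ' : ℝ} (h : JoinEntropyAt κ) (hle : κ' ≤ κ) : JoinEntropyAt κ' := by
  obtain ⟨c, hc, i₀, h⟩ := h
  refine ⟨c, hc, i₀, fun i hi => le_trans ?_ (h i hi)⟩
  have hi' : (0 : ℝ) ≤ i := Nat.cast_nonneg i
  have hpow : (2 : ℝ) ^ ((κ' - 1) * (i : ℝ)) ≤ (2 : ℝ) ^ ((κ - 1) * (i : ℝ)) :=
    Real.rpow_le_rpow_of_exponent_le (by norm_num) (by nlinarith)
  have := mul_le_mul_of_nonneg_left hpow hc.le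
  exact mul_le_mul_of_nonneg_right this (sq_nonneg _)

end Summit.CriticalPhenomena.SAWScalingLimit.Theorems.CriticalBubbleBound.Join

end
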